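/-
Copyright (c) 2026 the pub-hodgecm-mathlib formalisation cell (harness21).  Prover seat hodgecm-mathlib-LH4-p11 (g8), Track A «(D-RAM) FOUR-FRAME» squad, helper lane on
h413 = stmt-HodgeConjecture-24833 (count-neutral).  Heir dealer∕pen LH4-plan (g13) WORD #70 (2) ∕ #82 (B); SPEC-B2 v1 3227ed60 (A_L).  2026-09-04.
-/
import Summits.HodgeConjecture.HodgeConjecture.Theorems.F0P3cDyRamDiagonalLabelledOddOrbitCount   -- ★ p860280 (this seat, (B2a-3)): `cast_sum_mul_ncard_sepAt_eq_eight_mul_finsum_div_of_fibre_identity`; brings ★ LH4-p09 `shell_mapGL_diagGLUnits_iff`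
import Summits.HodgeConjecture.HodgeConjecture.Theorems.F0P3cDyRamLabelledOddCountDefs           -- ★ p860257 DEFS leaf (this seat): `valueClassLabel`, `labelledOddCount`, `IsTorusEquivariantLabel`
import HarnessLib

/-!
# Crux `H413`, line LH4 «(D-RAM) FOUR-FRAME» — (A_L) «THE LABELLED-ODD STAGE A OF (β-BAL)»: the signed eightfold clean-shell class-`+` census equals
# `8 · Σᶠ_{M₀ ∈ 𝓛₀(T), clean shell} labelledOddCount σ ϖ 0 i Λ M₀ ∕ [𝒰 : N(S̃'(M₀))]`, MODULO the per-orbit identity (B2a-2) (LH4-p10 (g6), SIG dbcde430) taken as a hypothesis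

Cell `hodgecm-mathlib` (D-0151), FLOOR 0, crux item H413 = `stmt-HodgeConjecture-24833`, route `HCCMUnconditional`; squad F0∕P3c∕LH4.  THEOREMS ONLY (no `def`, no instance,
no notation, no `sorry`, default heartbeats); ★-only imports; lane `--supports stmt-HodgeConjecture-24833 --as helper` (count-neutral); pays NO row, states NO law.

WHY.  ★ p860156 reduced (β-BAL) to the eightfold ODD-character vanishing `h8`; ★ p860198 ∕ ★ p860280 are the labelled Stage-A re-indexing and engine; ★ p860257 names the per-orbit
multiplicity `labelledOddCount`.  This file INSTANTIATES the engine at the data of `h8`: weight `(−1)^{s_i}`, invariant label = the clean-shell level triple of `X = diag(x₀, x₁, 0)`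
(★ LH4-p09 `shell_mapGL_diagGLUnits_iff`), vertex-read label = the value-class label `valueClassLabel σ ϖ x₀ x₁ m d M d_s` (= `h8`'s label by `Iff.rfl`), so that
the ONLY remaining orbit-level input is LH4-p10 (g6)'s (B2a-2) identity — carried here as the hypothesis `hfib` in exactly the SIG's shape (its `hΛ` is `isTorusEquivariantLabel_valueClassLabel` of the sibling brick `…ValueClassLabelEquivariant`).  Downstream (LH4-p05 (g8), END): `h8` ⟸ «for every slot `i`, `Σᶠ_{M₀ ∈ 𝓛₀(T), clean shell} labelledOddCount σ ϖ 0 i Λ M₀ ∕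
[𝒰 : N(S̃'(M₀))] = 0`» = the Stage-B table (p13 reads, p14 B3, p09∕p12 cells).
* HEAD `cast_sum_sign_mul_ncard_shell_valueClass_eq_eight_mul_finsum_of_fibre_identity` (generic `x₀ x₁ ℓ mc m d`; at `h8`: `x₀ = α−1`, `x₁ = β−1`, `ℓ = d%2`, `mc = mc d`, `m = m*`).
* `sum_sign_mul_ncard_shell_valueClass_eq_zero_of_fibre_identity_of_finsum_eq_zero` — the `h8` summand block VANISHES once the Stage-B finsum does (cast back to `ℤ`).
HONEST LABEL.  Count-neutral; the per-orbit identity and the Stage-B finsum are HYPOTHESES; eightfold vanishing, (β-BAL), (A″), (β), T₊ OPEN; `HC_CM` is proved only modulo the 7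
printed citations (2 remaining named inputs: hLiu418 = `stmt-HodgeConjecture-24832`, h413 = `stmt-HodgeConjecture-24833`) until rung 0 closes.

## References
* [Kottwitz1986BaseChangeUnits] R. E. Kottwitz, *Base change for unit elements of Hecke algebras*, Compositio Math. 60 (1986), §1 pp. 240–241.
* [Rogawski1990] J. D. Rogawski, *Automorphic Representations of Unitary Groups in Three Variables*, Ann. of Math. Stud. 123 (1990), §4.9 Prop. 4.9.1 (a)(b) p. 55, §4.10 p. 58.
* [LanglandsShelstad1987] R. P. Langlands, D. Shelstad, *On the definition of transfer factors*, Math. Ann. 278 (1987), §1.3, §3.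
-/

set_option autoImplicit false

noncomputable section

namespace Summit.HodgeConjecture.HodgeConjecture.Cruxes.H413.F0P3cDyRamLabelledOddStageA

open Literature.NumberTheory.Automorphic Literature.NumberTheory.Automorphic.HermitianLattice
open Literature.NumberTheory.Automorphic.UnitaryLatticeTree Literature.NumberTheory.Automorphic.UnitaryThreeFourFrame
open Summit.HodgeConjecture.HodgeConjecture.Cruxes.H413.F0P3cDyRamFourFramePieces
open Summit.HodgeConjecture.HodgeConjecture.Cruxes.H413.F0P3cDyRamFourFrameCensusDefs
open Summit.HodgeConjecture.HodgeConjecture.Cruxes.H413.F0P3cDyRamDiagonalTorusDefs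
open Summit.HodgeConjecture.HodgeConjecture.Cruxes.H413.F0P3cDyRamLabelledOddCountDefs
open Summit.HodgeConjecture.HodgeConjecture.Cruxes.H413.F0P3cDyRamDiagonalOrbitCountLabelled (shell_mapGL_diagGLUnits_iff)
open Summit.HodgeConjecture.HodgeConjecture.Cruxes.H413.F0P3cDyRamDiagonalLabelledOddOrbitCount
open scoped Valued WithZero Matrix MatrixGroups

variable {K : Type} [Field K] [Valued K ℤᵐ⁰] [Finite 𝓀[K]]

/-- **HEAD — (A_L), THE LABELLED-ODD STAGE A OF (β-BAL), MODULO THE PER-ORBIT IDENTITY (B2a-2).**  `σ` an isometric involution, uniformiser `ϖ = ↑ϖu`, `u` a `σ`-fixed NON-NORM unit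
with the index-two dichotomy, `T = diag(s)` a regular unit diagonal, `X = diag(x₀, x₁, 0)`, shell levels `(ℓ, mc)`, label level `m`, depth letter `d`, slot `i`.  IF for every
`M₀ ∈ 𝓛₀(T)` on the clean shell the identity of SIG (B2a-2) holds at `Λ = valueClassLabel σ ϖ x₀ x₁ m d`, type `0`:
`(Σ_e (−1)^{e_i} · Σᶠ_{M ∈ 𝒯·M₀} #{a : diag(ϖu^{a})·M type 0 for diag(d_e) ∧ Λ (diag(ϖu^{a})·M) d_e}) · [𝒰 : N(S̃'(M₀))] = 8 · [𝒯 : S̃'(M₀)] · labelledOddCount σ ϖ 0 i Λ M₀`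
(`hΛ` for it: `…ValueClassLabelEquivariant.isTorusEquivariantLabel_valueClassLabel`), THEN
`↑(Σ_e (−1)^{e_i} · #{M : type 0 for diag(d_e), T·M = M, XM ⊆ ϖ^ℓM ⊄ ϖ^{ℓ+1}M, X²M ⊆ ϖ^{mc}M, Λ M d_e}) = 8 · Σᶠ_{M₀ ∈ 𝓛₀(T), shell} labelledOddCount σ ϖ 0 i Λ M₀ ∕ [𝒰 : N(S̃'(M₀))]`
(★ p860280 at `χ = (−1)^{e_i}`, `Q` = the shell triple — invariant by ★ `shell_mapGL_diagGLUnits_iff` —, `P e M = Λ M d_e`, `L = labelledOddCount σ ϖ 0 i Λ`).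
[cite: Kottwitz1986BaseChangeUnits, §1 pp. 240–241] [cite: Rogawski1990, §4.9 Prop. 4.9.1 (a)(b) p. 55, §4.10 p. 58] [cite: LanglandsShelstad1987, §3] -/
theorem cast_sum_sign_mul_ncard_shell_valueClass_eq_eight_mul_finsum_of_fibre_identity {σ : K →+* K} (hσ : ∀ x, σ (σ x) = x)
    (hvσ : ∀ a, Valued.v (σ a) = Valued.v a) {ϖ : K} (hϖ : Valued.v ϖ = WithZero.exp (-1 : ℤ)) (ϖu : Kˣ) (hϖu : (ϖu : K) = ϖ)
    {u : K} (hσu : σ u = u) (hvu : Valued.v u = 1) (hun : ¬ ∃ z : K, z * σ z = u)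
    (hdich : ∀ x : K, σ x = x → x ≠ 0 → (∃ z : K, z * σ z = x) ∨ ∃ z : K, z * σ z = u * x)
    {s : Fin 3 → K} (hs : ∀ i, Valued.v (s i) = 1) (hreg : ∀ i j, i ≠ j → s i ≠ s j)
    (T : GL (Fin 3) K) (hT : (T : Matrix (Fin 3) (Fin 3) K) = Matrix.diagonal s) (x₀ x₁ : K) (ℓ mc m d : ℕ) (i : Fin 3)
    (hfib : ∀ M₀ ∈ normalisedStableLattices T,
      (LatticeInLevel ϖ ℓ (Matrix.diagonal ![x₀, x₁, 0]) M₀ ∧ ¬ LatticeInLevel ϖ (ℓ + 1) (Matrix.diagonal ![x₀, x₁, 0]) M₀ ∧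
        LatticeInLevel ϖ mc (Matrix.diagonal ![x₀ * x₀, x₁ * x₁, 0]) M₀) →
      (∑ e : Fin 3 → Bool, ((if e i then (-1 : ℤ) else 1 : ℤ) : ℚ) *
          ((∑ᶠ M ∈ {M : Submodule 𝒪[K] (Fin 3 → K) | ∃ z ∈ unitTorus K 3, M = mapGL (diagGLUnits z) M₀},
            ({a : Fin 3 → ℤ | IsVertexLattice σ ϖ (Matrix.diagonal fun j => if e j then u else (1 : K)) 0 (mapGL (diagGLUnits fun j => ϖu ^ a j) M) ∧
              valueClassLabel σ ϖ x₀ x₁ m d (mapGL (diagGLUnits fun j => ϖu ^ a j) M) (fun j => if e j then u else (1 : K))} : Set _).ncard : ℕ) : ℚ)) *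
        ((((unitStabilizer M₀).map (unitNormMap σ 3)).relIndex (fixedUnitTorus σ 3) : ℕ) : ℚ) =
      8 * (((unitStabilizer M₀).relIndex (unitTorus K 3) : ℕ) : ℚ) * (labelledOddCount σ ϖ 0 i (valueClassLabel σ ϖ x₀ x₁ m d) M₀ : ℚ)) :
    (((∑ e : Fin 3 → Bool, (if e i then (-1 : ℤ) else 1) *
        ({M : Submodule 𝒪[K] (Fin 3 → K) | IsVertexLattice σ ϖ (Matrix.diagonal fun j => if e j then u else (1 : K)) 0 M ∧ mapGL T M = M ∧
          ((LatticeInLevel ϖ ℓ (Matrix.diagonal ![x₀, x₁, 0]) M ∧ ¬ LatticeInLevel ϖ (ℓ + 1) (Matrix.diagonal ![x₀, x₁, 0]) M ∧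
              LatticeInLevel ϖ mc (Matrix.diagonal ![x₀ * x₀, x₁ * x₁, 0]) M) ∧
            valueClassLabel σ ϖ x₀ x₁ m d M (fun j => if e j then u else (1 : K)))}.ncard : ℤ) : ℤ) : ℚ)) =
      8 * ∑ᶠ M₀ ∈ {M | M ∈ normalisedStableLattices T ∧
          (LatticeInLevel ϖ ℓ (Matrix.diagonal ![x₀, x₁, 0]) M ∧ ¬ LatticeInLevel ϖ (ℓ + 1) (Matrix.diagonal ![x₀, x₁, 0]) M ∧
            LatticeInLevel ϖ mc (Matrix.diagonal ![x₀ * x₀, x₁ * x₁, 0]) M)},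
        (labelledOddCount σ ϖ 0 i (valueClassLabel σ ϖ x₀ x₁ m d) M₀ : ℚ) /
          ((((unitStabilizer M₀).map (unitNormMap σ 3)).relIndex (fixedUnitTorus σ 3) : ℕ) : ℚ) :=
  cast_sum_mul_ncard_sepAt_eq_eight_mul_finsum_div_of_fibre_identity hσ hvσ hϖ ϖu hϖu hσu hvu hun hdich hs hreg T hT 0
    (fun e => if e i then (-1 : ℤ) else 1)
    (fun M => LatticeInLevel ϖ ℓ (Matrix.diagonal ![x₀, x₁, 0]) M ∧ ¬ LatticeInLevel ϖ (ℓ + 1) (Matrix.diagonal ![x₀, x₁, 0]) M ∧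
      LatticeInLevel ϖ mc (Matrix.diagonal ![x₀ * x₀, x₁ * x₁, 0]) M)
    (fun z M => shell_mapGL_diagGLUnits_iff ϖ ℓ mc ![x₀, x₁, 0] ![x₀ * x₀, x₁ * x₁, 0] z M)
    (fun e M => valueClassLabel σ ϖ x₀ x₁ m d M (fun j => if e j then u else (1 : K)))
    (fun M₀ => labelledOddCount σ ϖ 0 i (valueClassLabel σ ϖ x₀ x₁ m d) M₀) hfib

/-- **THE `h8` BLOCK VANISHES ONCE THE STAGE-B FINSUM DOES.**  Same data; if moreover the Stage-B table sums to zero —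
`Σᶠ_{M₀ ∈ 𝓛₀(T), shell} labelledOddCount σ ϖ 0 i Λ M₀ ∕ [𝒰 : N(S̃'(M₀))] = 0` — then the signed eightfold count of the `h8` block of ★ p860156 (slot `i`) is `0` in `ℤ`
(the label written as `valueClassLabel`, = the `h8` text by `Iff.rfl`, cf. `…ValueClassLabelEquivariant.valueClassLabel_signRep_iff`). [cite: Kottwitz1986BaseChangeUnits, §1 pp. 240–241] [cite: LanglandsShelstad1987, §3] -/
theorem sum_sign_mul_ncard_shell_valueClass_eq_zero_of_fibre_identity_of_finsum_eq_zero {σ : K →+* K} (hσ : ∀ x, σ (σ x) = x)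
    (hvσ : ∀ a, Valued.v (σ a) = Valued.v a) {ϖ : K} (hϖ : Valued.v ϖ = WithZero.exp (-1 : ℤ)) (ϖu : Kˣ) (hϖu : (ϖu : K) = ϖ)
    {u : K} (hσu : σ u = u) (hvu : Valued.v u = 1) (hun : ¬ ∃ z : K, z * σ z = u)
    (hdich : ∀ x : K, σ x = x → x ≠ 0 → (∃ z : K, z * σ z = x) ∨ ∃ z : K, z * σ z = u * x)
    {s : Fin 3 → K} (hs : ∀ i, Valued.v (s i) = 1) (hreg : ∀ i j, i ≠ j → s i ≠ s j)
    (T : GL (Fin 3) K) (hT : (T : Matrix (Fin 3) (Fin 3) K) = Matrix.diagonal s) (x₀ x₁ : K) (ℓ mc m d : ℕ) (i : Fin 3)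
    (hfib : ∀ M₀ ∈ normalisedStableLattices T,
      (LatticeInLevel ϖ ℓ (Matrix.diagonal ![x₀, x₁, 0]) M₀ ∧ ¬ LatticeInLevel ϖ (ℓ + 1) (Matrix.diagonal ![x₀, x₁, 0]) M₀ ∧
        LatticeInLevel ϖ mc (Matrix.diagonal ![x₀ * x₀, x₁ * x₁, 0]) M₀) →
      (∑ e : Fin 3 → Bool, ((if e i then (-1 : ℤ) else 1 : ℤ) : ℚ) *
          ((∑ᶠ M ∈ {M : Submodule 𝒪[K] (Fin 3 → K) | ∃ z ∈ unitTorus K 3, M = mapGL (diagGLUnits z) M₀},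
            ({a : Fin 3 → ℤ | IsVertexLattice σ ϖ (Matrix.diagonal fun j => if e j then u else (1 : K)) 0 (mapGL (diagGLUnits fun j => ϖu ^ a j) M) ∧
              valueClassLabel σ ϖ x₀ x₁ m d (mapGL (diagGLUnits fun j => ϖu ^ a j) M) (fun j => if e j then u else (1 : K))} : Set _).ncard : ℕ) : ℚ)) *
        ((((unitStabilizer M₀).map (unitNormMap σ 3)).relIndex (fixedUnitTorus σ 3) : ℕ) : ℚ) =
      8 * (((unitStabilizer M₀).relIndex (unitTorus K 3) : ℕ) : ℚ) * (labelledOddCount σ ϖ 0 i (valueClassLabel σ ϖ x₀ x₁ m d) M₀ : ℚ))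
    (hB : ∑ᶠ M₀ ∈ {M | M ∈ normalisedStableLattices T ∧
          (LatticeInLevel ϖ ℓ (Matrix.diagonal ![x₀, x₁, 0]) M ∧ ¬ LatticeInLevel ϖ (ℓ + 1) (Matrix.diagonal ![x₀, x₁, 0]) M ∧
            LatticeInLevel ϖ mc (Matrix.diagonal ![x₀ * x₀, x₁ * x₁, 0]) M)},
        (labelledOddCount σ ϖ 0 i (valueClassLabel σ ϖ x₀ x₁ m d) M₀ : ℚ) /
          ((((unitStabilizer M₀).map (unitNormMap σ 3)).relIndex (fixedUnitTorus σ 3) : ℕ) : ℚ) = 0) :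
    (∑ e : Fin 3 → Bool, (if e i then (-1 : ℤ) else 1) *
        ({M : Submodule 𝒪[K] (Fin 3 → K) | IsVertexLattice σ ϖ (Matrix.diagonal fun j => if e j then u else (1 : K)) 0 M ∧ mapGL T M = M ∧
          ((LatticeInLevel ϖ ℓ (Matrix.diagonal ![x₀, x₁, 0]) M ∧ ¬ LatticeInLevel ϖ (ℓ + 1) (Matrix.diagonal ![x₀, x₁, 0]) M ∧
              LatticeInLevel ϖ mc (Matrix.diagonal ![x₀ * x₀, x₁ * x₁, 0]) M) ∧
            valueClassLabel σ ϖ x₀ x₁ m d M (fun j => if e j then u else (1 : K)))}.ncard : ℤ)) = 0 := by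
  have h := cast_sum_sign_mul_ncard_shell_valueClass_eq_eight_mul_finsum_of_fibre_identity hσ hvσ hϖ ϖu hϖu hσu hvu hun hdich hs hreg T hT x₀ x₁ ℓ mc m d i hfib
  rw [hB, mul_zero] at h
  exact_mod_cast h

end Summit.HodgeConjecture.HodgeConjecture.Cruxes.H413.F0P3cDyRamLabelledOddStageA

end
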